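import Mathlib
import HarnessLib
import Summits.HubbardSuperconductivity.HubbardSuperconductivity.Theses.ComplexGFFStiffness
import Summits.HubbardSuperconductivity.HubbardSuperconductivity.Theorems.ComplexGFFStiffnessHypALocalTwoPointFreeEnergyBoundsOfShrunkSlots

/-!
# Route `ComplexGFFStiffness`, child `F1Residual` of the crux `HypACumulant` (and, by the same statement, of
# the registered stub `stub_twoPointGivenZ` of the crux `HypALocalTwoPoint`) — CLOSED

The route child `F1Residual` (item `stmt-HubbardSuperconductivity-27417`; rev-5 re-typing on the shrunk state ball of
the split child 27381 of the crux `HypACumulant` by the crux-strategist; census entry "F1 residual" of the stub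
`stub_twoPointGivenZ ⇐ FreeEnergyBounds`) is by definition
`GradientRG.F4StatementShrink 4 → GradientRG.H1bcStatementShrink 4 → Theorems.ComplexGFF.FreeEnergyBounds`: the
RESIDUAL ASSEMBLY from the nine `q`-slots and the state slot with `N`-free sizes (on the shrunk package `P.shrink`,
state-ball radius `r/8`) to the `N`-uniform first and mixed second difference bounds of the finite-volume free energy
([ABKM19] Thm 2.2, `ℓ ≤ 2`, difference form, `ι`-symmetric complex class).  It is
`Theorems.ComplexGFF.freeEnergyBounds_of_shrunkSlots` (per-`L` parameter choice of `gnv_of_torusFRD` with orders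
`(16, 19)`; sizes from the two hypotheses; `ρ, ε, ρ_𝒦` after the sizes via `freeEnergy_allN_of_slots` applied to
`P.shrink`; `exists_freeEnergyConsts_of_slots` + `pertZ_eq_Z0_mul_exp_of_seed` at every height).

Honest scope: this closes ONE child of a rung route (stiffness of a complex Gaussian gradient field via the
[ABKM19] renormalisation group) — a CONDITIONAL assembly (`H1bcStatementShrink 4` is a theorem of the tree,
`F4StatementShrink 4` ⇐ `TwoKernelSkBound 4 ∧ F4l2Shrink 4` is open); it does not prove either crux, the route, or
anything about superconductivity in the Hubbard model.

## References
* S. Adams, S. Buchholz, R. Kotecký, S. Müller, arXiv:1910.13564, Thm 2.2 / Ch. 4 (4.4)–(4.12) / Lemma 12.6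
  [AdamsBuchholzKoteckyMuller2019].
* S. Buchholz, J. Funct. Anal. 275 (2018), Thm 2.4 / Thm 4.5 [Buchholz2016].
-/

-- `Summit.<Summit>.<Problem>`: single-conjunct summit, the duplicate component is mandated (D-0017).
set_option linter.dupNamespace false

namespace Summit.HubbardSuperconductivity.HubbardSuperconductivity.Theorems

/-- **The route child `F1Residual` holds**: `F4StatementShrink 4 → H1bcStatementShrink 4 → FreeEnergyBounds` is
`Theorems.ComplexGFF.freeEnergyBounds_of_shrunkSlots`. [cite: AdamsBuchholzKoteckyMuller2019, Thm 2.2 / Lemma 12.6] -/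
theorem F1Residual_proof :
    Summit.HubbardSuperconductivity.HubbardSuperconductivity.Theses.ComplexGFFStiffness.F1Residual := by
  unfold Summit.HubbardSuperconductivity.HubbardSuperconductivity.Theses.ComplexGFFStiffness.F1Residual
  exact Summit.HubbardSuperconductivity.HubbardSuperconductivity.Theorems.ComplexGFF.freeEnergyBounds_of_shrunkSlots

end Summit.HubbardSuperconductivity.HubbardSuperconductivity.Theorems
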